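import Summits.ABC.ABC.Theses.IUTThetaPilot
import Literature.IUT.LogVolume.Corollary22Thm110LegendreWitness
import HarnessLib

set_option linter.dupNamespace false

/-!
# Route `route-ABC-IUTThetaPilot`, crux `ThetaPartII` (stmt-ABC-19678) is CONTENTFUL: it forces (C1), (C2)
# of [IUTchIV] Cor. 2.2 (ii) at rational points of the `λ`-line with arbitrarily large `log(q^∀)`

The crux of the route file `Summits/ABC/ABC/Theses/IUTThetaPilot.lean` is

  `ThetaPartII : Prop := ∃ HII : ℝ, ∀ D : GenEll.CBData, Cor22.Hypotheses D → Cor22.PartII D HII`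

— [IUTchIV] Corollary 2.2 (ii), uniform in the compactly bounded subset (S. Mochizuki, *Inter-universal
Teichmüller theory IV*, RIMS manuscript (Apr. 2020) = PRIMS **57** (2021), Cor. 2.2, pp. 41–43)
[claim: Mochizuki2012, status: disputed]. `Cor22.PartII D H` lets every point of `K_V ∩ U_X(ℚ̄)^{≤d}` either lie
in a finite exceptional set `Exc_d`, on which `log(q^∀)` is BOUNDED (by `H·ε_d^{−3}·d^{4+ε_d} + H_K`), or carry a
prime `l ≥ 5` with (C1), (C2). A universally quantified crux could in principle be vacuous (no admissible `D`)
or trivially satisfiable (every point exceptional). This proof-only file (cell abc-iut, seat abc-iut-S-d3;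
`--supports stmt-ABC-19678`) records in the kernel that NEITHER happens: by abc-iut-w5-d056's
`Cor22.hypotheses_std` the standard `K_V = CBData.std {2}` (abc-iut-S4) is admissible, and by abc-iut-S-d3's
`Cor22.exists_ratPoint_mem_std_two` it contains `ℚ`-points of `U_X` with `log(q^∀)` above ANY bound, hence
outside every `Exc_1`; so `ThetaPartII` yields, at rational `λ` of arbitrarily large `log(q^∀(λ))`, a prime
`l ≥ 5` with (C1) `√(log q^∀) ≤ l ≤ 10δ·√(log q^∀)·log(2δ·log q^∀)` and (C2)
`(1/6)·log(q^∀) ≤ (1 + ε_E)·(log-diff + log-cond) + C_K` — a Szpiro-type inequality with `C_K` uniform on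
`K_V` (`theorem ThetaPartII_content`). HONEST FRAMING: nothing here asserts `ThetaPartII`, [IUTchIV] Cor. 2.2 or
[IUTchIII] Cor. 3.12; the theorem says what the crux CLAIMS at explicit points, which is also where a refuter
would have to look. Classical arithmetic only.
-/

namespace Summit.ABC.ABC.Theorems

open Literature.NumberTheory.DiophantineGeometry Literature.NumberTheory.DiophantineGeometry.GenEll
open Literature.IUT.LogVolume

/-- **The crux `ThetaPartII` is contentful.** If `Summit.ABC.ABC.Theses.IUTThetaPilot.ThetaPartII` holds then
for every `H` there are a `ℚ`-point `P` of `U_X` in the standard compactly bounded subset `CBData.std {2}` with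
`H < log(q^∀(P))`, a prime `l ≥ 5` and the constant `C_K > 0` of Cor. 2.2 (ii) for that `K_V` such that
(C1), (C2) hold at `(P, l)` in degree `d = 1` (`Cor22.ConditionsC1C2 1 C_K P l`). Proof: apply `PartII` to
`K_V = CBData.std {2}` (admissible: `Cor22.hypotheses_std`) with `d = 1`, `ε_1 = 1`; `log(q^∀)` is bounded on
`Exc_1`, and `Cor22.exists_ratPoint_mem_std_two` supplies a point of `K_V ∩ U_X(ℚ̄)^{≤1}` above that bound and
above `H`. [cite: Mochizuki2012, IUTchIV Cor. 2.2 (ii) pp.41-43] -/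
theorem ThetaPartII_content (h : Summit.ABC.ABC.Theses.IUTThetaPilot.ThetaPartII) (H : ℝ) :
    ∃ (P : NFPoint) (l : ℕ) (CK : ℝ), P ∈ (CBData.std {2} (by simp [Nat.prime_two])).toSet ∧ P ∈ UPle 1 ∧
      H < Cor22.logQForall P ∧ l.Prime ∧ 5 ≤ l ∧ 0 < CK ∧ Cor22.ConditionsC1C2 1 CK P l := by
  unfold Summit.ABC.ABC.Theses.IUTThetaPilot.ThetaPartII at h
  obtain ⟨HII, hII⟩ := h
  have hS : ∀ p ∈ ({2} : Finset ℕ), p.Prime := by simp [Nat.prime_two]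
  obtain ⟨CK, HK, hCK, -, hd⟩ :=
    hII (CBData.std {2} hS) (Cor22.hypotheses_std _ _ (Finset.mem_singleton_self 2))
  obtain ⟨Exc, -, -, -, hbound, htail⟩ := hd 1 le_rfl 1 one_pos le_rfl
  obtain ⟨B, hB⟩ : ∃ B : ℝ, ∀ P ∈ Exc, Cor22.logQForall P ≤ B := ⟨_, hbound⟩
  obtain ⟨q, hmem, hU1, -, hbig, -⟩ := Cor22.exists_ratPoint_mem_std_two hS (max H B)
  have hnot : ratPoint q ∉ Exc := fun hP => by
    have h1 := hB _ hP
    have h2 := lt_of_le_of_lt (le_max_right H B) hbig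
    linarith
  obtain ⟨l, hl, h5, hC⟩ := htail (ratPoint q) ⟨hmem, hU1⟩ hnot
  exact ⟨ratPoint q, l, CK, hmem, hU1, lt_of_le_of_lt (le_max_left _ _) hbig, hl, h5, hCK, hC⟩

/-- **In particular (C2) of [IUTchIV] Cor. 2.2 (ii) at rational points of unbounded `log(q^∀)`**: under
`ThetaPartII`, for every `H` some `ℚ`-point `P` of the standard `K_V` with `H < log(q^∀(P))` satisfies
`(1/6)·log(q^∀(P)) ≤ (1 + ε_E(1, P))·(log-diff(P) + log-cond(P)) + C_K` with `C_K > 0` depending only on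
`K_V` — the Szpiro-type content of the crux on the `λ`-line over `ℚ`. [cite: Mochizuki2012, IUTchIV Cor. 2.2 (ii) (C2) p.42] -/
theorem ThetaPartII_szpiro_content (h : Summit.ABC.ABC.Theses.IUTThetaPilot.ThetaPartII) (H : ℝ) :
    ∃ (P : NFPoint) (CK : ℝ), P ∈ (CBData.std {2} (by simp [Nat.prime_two])).toSet ∧ P ∈ UPle 1 ∧
      H < Cor22.logQForall P ∧ 0 < CK ∧
      1 / 6 * Cor22.logQForall P ≤ (1 + Cor22.epsilonE 1 P) * (P.logDiff + P.logCond) + CK := by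
  obtain ⟨P, l, CK, hmem, hU1, hH, -, -, hCK, hC⟩ := ThetaPartII_content h H
  exact ⟨P, CK, hmem, hU1, hH, hCK, hC.2.2.2.2⟩

end Summit.ABC.ABC.Theorems
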